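import Summits.BirchSwinnertonDyer.Rank1Residual.X12.CMTwoTorsionExact
import HarnessLib

/-!
# The rational `2`-torsion of CM elliptic curves over `ℚ`, completed: NO rational point of order `2`
# when `2` is inert in the CM field (`d_K ∈ {−11, −19, −43, −67, −163}`, and `j = −12288000`);
# the full table for the twelve CM `j`-invariants `≠ 0`; twist-invariance of rational `2`-torsion

HONEST FRAMING (cell `b2b-bsdres`, run/shared/lean/b2b/bsd-rank1-residual/, verbatim in every
file): the goal of the cell is to DELETE the COMBINATION-SHAPED residual classes of the
Birch–Swinnerton-Dyer formula for ALL analytic-rank `≤ 1` elliptic curves over `ℚ` — "full BSD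
formula for every rank `≤ 1` curve in class `C`" assembled STRICTLY from published theorems — so
that the rank-`≤ 1` remainder becomes exactly the CONSTRUCTION-SHAPED classes, which are TYPED
(missing-input `Prop`s), NOT attempted. This is not "finishing BSD". Literature typer seat
`b2b-bsdres-lit-bst` ("the `p = 2, 3` and CM corner statements identified precisely"), gen 5, third
file. THEOREMS ONLY (no definition, no named fact, no axiom, no table lookup, no certificate).
Nothing is booked; no label and no census number moves; class X12 REMAINS CONSTRUCTION-SHAPED.

## What is proved

`X12/CMTwoTorsion.lean` / `X12/CMTwoTorsionExact.lean` (p245325 / p245463) reduce "rational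
`2`-torsion on EVERY elliptic curve with `j = j₀ ∉ {0, 1728}`" to the single cubic
`Y³ − 27aY − 54a ∈ ℚ[Y]`, `a = j₀/(j₀ − 1728)` (both directions), and settle the six CM
`j`-invariants where that cubic HAS a rational root (`j ∈ {1728, 287496, −3375, 16581375, 8000,
54000}`). Here the other six CM `j`-invariants `≠ 0` are settled in the negative — completing
harvest-1's odd-`p` theorem `X12.eq_zero_of_nsmul_eq_zero_of_hasCM` (`p ≥ 5`) at `p = 2`:

* `int_cubic_of_rat_root`, `no_rat_root_of_zmod` (elementary): a rational root `Y = u/v` of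
  `A·Y³ − C·Y − D` (`A, C, D ∈ ℕ`) gives `A u³ − C u v² − D v³ = 0` in `ℤ` with `gcd(u, v) = 1`, which
  is impossible as soon as, for some prime `ℓ ∤ A`, the cubic `A t³ − C t − D` has no root in `ℤ/ℓ`
  (`ℓ ∣ v` would give `ℓ ∣ u`; `ℓ ∤ v` would make `u/v mod ℓ` a root) — a `decide` over `ℓ` residues.
* `no_twoTorsion_of_j_eq_of_zmod` (the generic criterion) and its six instances
  `no_twoTorsion_of_j_eq_neg_32768` (`K = ℚ(√−11)`; cubic `539Y³ − 13824Y − 27648`, `ℓ = 5`),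
  `…_neg_884736` (`ℚ(√−19)`; `19Y³ − 512Y − 1024`, `ℓ = 5`), `…_neg_884736000` (`ℚ(√−43)`;
  `18963Y³ − 512000Y − 1024000`, `ℓ = 11`), `…_neg_147197952000` (`ℚ(√−67)`;
  `3154963Y³ − 85184000Y − 170368000`, `ℓ = 17`), `…_neg_262537412640768000` (`ℚ(√−163)`;
  `5627087890963Y³ − 151931373056000Y − 303862746112000`, `ℓ = 41`), `…_neg_12288000` (the
  order `ℤ[3ζ₃]` of conductor `3` in `ℚ(√−3)`; `64009Y³ − 1728000Y − 3456000`, `ℓ = 7`): on every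
  `E/ℚ` with that `j`, `2 • P = 0 → P = 0`.
* In the cell's vocabulary: `no_twoTorsion_of_cmFieldDiscrOfJ_eq_neg_eleven / _nineteen /
  _fortythree / _sixtyseven / _onesixtythree`.
* **The table** `exists_twoTorsion_iff_of_cm_j_ne_zero`: for `E/ℚ` with `j(E)` one of the twelve
  CM `j`-invariants other than `0` (`cmFieldDiscrOfJ (j E) ≠ 0`, `j E ≠ 0`):
  `(∃ P ≠ O, 2P = O) ↔ d_K ∈ {−4, −7, −8} ∨ j = 54000`. (`j = 0`: depends on the sextic twist —
  `y² = x³ + k` has a rational point of order `2` iff `k` is a cube — not a statement about `j`.)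
* `exists_twoTorsion_of_j_eq_of_exists_twoTorsion` (any field of characteristic `0`): rational
  `2`-torsion is constant on `{E : j(E) = j₀}` for `j₀ ∉ {0, 1728}` (all quadratic twists at once).

## References
* J. H. Silverman, *The Arithmetic of Elliptic Curves*, 2nd ed., GTM 106 (2009), III §1, III.2.3,
  App. A §3. [SilvermanAEC2009]
* A. Burungale, F. Castella, C. Skinner, Y. Tian, Ann. Math. Québec 46 (2022), Rem. D (p. 327)
  (the `ℚ(√−7)` row of the table). [BurungaleCastellaSkinnerTian2022]
-/

set_option autoImplicit false

open WeierstrassCurve Literature.NumberTheory.EllipticCurves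
  Literature.NumberTheory.EllipticCurves.Rank1Residual
  Literature.NumberTheory.EllipticCurves.BurungaleCastellaSkinnerTian2022

namespace Summit.BirchSwinnertonDyer.Rank1Residual.X12

/-! ### An integer cubic with only the trivial zero mod `ℓ` has no rational root -/

/-- A rational root `Y` of `A·Y³ − C·Y − D` gives the integer relation
`A·u³ − C·u·v² − D·v³ = 0` for `u = Y.num`, `v = Y.den`. [folklore] -/
theorem int_cubic_of_rat_root (A C D : ℕ) (Y : ℚ)
    (h : (A : ℚ) * Y ^ 3 - C * Y - D = 0) :
    (A : ℤ) * Y.num ^ 3 - C * Y.num * (Y.den : ℤ) ^ 2 - D * (Y.den : ℤ) ^ 3 = 0 := by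
  obtain ⟨u, v, hv, hYuv, hnum, hden⟩ :
      ∃ u : ℤ, ∃ v : ℕ, (v : ℚ) ≠ 0 ∧ Y = u / v ∧ Y.num = u ∧ Y.den = v :=
    ⟨Y.num, Y.den, by exact_mod_cast Y.den_nz, (Rat.num_div_den Y).symm, rfl, rfl⟩
  rw [hnum, hden]
  have h' : ((A : ℚ) * u ^ 3 - C * u * (v : ℚ) ^ 2 - D * (v : ℚ) ^ 3) =
      (v : ℚ) ^ 3 * ((A : ℚ) * Y ^ 3 - C * Y - D) := by
    rw [hYuv]
    field_simp
  rw [h, mul_zero] at h'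
  exact_mod_cast h'

/-- If for a prime `ℓ` with `ℓ ∤ A` the cubic `A t³ − C t − D` has NO root in `ℤ/ℓ`, then
`A·Y³ − C·Y − D` has no rational root: for a root `u/v` in lowest terms, `ℓ ∣ v` would force
`ℓ ∣ A u³`, i.e. `ℓ ∣ u`, while `ℓ ∤ v` would make `u/v mod ℓ` a root. [folklore] -/
theorem no_rat_root_of_zmod {A C D : ℕ} {ℓ : ℕ} (hℓ : ℓ.Prime) (hA : (A : ZMod ℓ) ≠ 0)
    (hroot : ∀ t : ZMod ℓ, (A : ZMod ℓ) * t ^ 3 - C * t - D ≠ 0)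
    (Y : ℚ) (h : (A : ℚ) * Y ^ 3 - C * Y - D = 0) : False := by
  haveI : Fact ℓ.Prime := ⟨hℓ⟩
  have hint := int_cubic_of_rat_root A C D Y h
  have hz := congrArg (fun z : ℤ ↦ (z : ZMod ℓ)) hint
  push_cast at hz
  by_cases hv : (Y.den : ZMod ℓ) = 0
  · rw [hv] at hz
    have hu3 : (A : ZMod ℓ) * (Y.num : ZMod ℓ) ^ 3 = 0 := by simpa using hz
    have hu : (Y.num : ZMod ℓ) = 0 := by
      rcases mul_eq_zero.mp hu3 with h' | h'
      · exact absurd h' hA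
      · exact (pow_eq_zero_iff three_ne_zero).mp h'
    rw [ZMod.intCast_zmod_eq_zero_iff_dvd] at hu
    rw [ZMod.natCast_eq_zero_iff] at hv
    have hu' : ℓ ∣ Y.num.natAbs := Int.natCast_dvd_natCast.mp (Int.dvd_natAbs.mpr hu)
    exact hℓ.one_lt.ne' (Nat.eq_one_of_dvd_coprimes Y.reduced hu' hv)
  · refine hroot ((Y.num : ZMod ℓ) / (Y.den : ZMod ℓ)) ?_
    have hd3 : (Y.den : ZMod ℓ) ^ 3 ≠ 0 := pow_ne_zero 3 hv
    have hmul : ((A : ZMod ℓ) * ((Y.num : ZMod ℓ) / (Y.den : ZMod ℓ)) ^ 3 -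
        C * ((Y.num : ZMod ℓ) / (Y.den : ZMod ℓ)) - D) * (Y.den : ZMod ℓ) ^ 3 = 0 := by
      have e : ((A : ZMod ℓ) * ((Y.num : ZMod ℓ) / (Y.den : ZMod ℓ)) ^ 3 -
          C * ((Y.num : ZMod ℓ) / (Y.den : ZMod ℓ)) - D) * (Y.den : ZMod ℓ) ^ 3 =
          (A : ZMod ℓ) * (Y.num : ZMod ℓ) ^ 3 - C * (Y.num : ZMod ℓ) * (Y.den : ZMod ℓ) ^ 2 -
            D * (Y.den : ZMod ℓ) ^ 3 := by
        field_simp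
      rw [e]
      exact hz
    exact (mul_eq_zero.mp hmul).resolve_right hd3

/-! ### The generic criterion and the six negative CM cases -/

section OverRat

variable (W : WeierstrassCurve ℚ) [W.IsElliptic]

/-- **No rational `2`-torsion from a mod-`ℓ` obstruction.** Let `j(E) = j₀ ∉ {0, 1728}`,
`a(j₀ − 1728) = j₀`, and let `A, C, D ∈ ℕ` with `27aA = C`, `54aA = D` (so `A·(Y³ − 27aY − 54a) =
AY³ − CY − D`). If for some prime `ℓ ∤ A` the cubic `At³ − Ct − D` has no root in `ℤ/ℓ`, then `E(ℚ)` has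
no point of order `2`. (Converse chain of `CMTwoTorsionExact.lean` +
`no_rat_root_of_zmod`.) [cite: SilvermanAEC2009, III §1 and III.2.3] -/
theorem no_twoTorsion_of_j_eq_of_zmod {j₀ a : ℚ} (hj : W.j = j₀) (h0 : j₀ ≠ 0)
    (h1728 : j₀ ≠ 1728) (ha : a * (j₀ - 1728) = j₀) {A C D : ℕ} (hC : 27 * a * A = C)
    (hD : 54 * a * A = D) {ℓ : ℕ} (hℓ : ℓ.Prime) (hA : (A : ZMod ℓ) ≠ 0)
    (hroot : ∀ t : ZMod ℓ, (A : ZMod ℓ) * t ^ 3 - C * t - D ≠ 0)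
    (P : W.toAffine.Point) (h2 : 2 • P = 0) : P = 0 := by
  by_contra hP
  rcases P with _ | ⟨x, y, h⟩
  · exact hP rfl
  obtain ⟨hY, -⟩ := yCubic_root_of_two_nsmul_eq_zero W hj h0 h1728 ha h2
  set Y := W.c₄ / W.c₆ * (36 * x + 3 * W.b₂)
  have h' : (A : ℚ) * Y ^ 3 - C * Y - D = 0 := by
    rw [← hC, ← hD]
    linear_combination (A : ℚ) * hY
  exact no_rat_root_of_zmod hℓ hA hroot Y h'

/-- **`j = −32768 = −32³`** (CM by `ℤ[(1+√−11)/2]`; `121b`-type curves and their twists): NO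
rational point of order `2` (`a = 512/539`; `539Y³ − 13824Y − 27648` has only the trivial zero
mod `5`). [cite: SilvermanAEC2009, III §1 and App. A §3] -/
theorem no_twoTorsion_of_j_eq_neg_32768 (hj : W.j = -32768) (P : W.toAffine.Point)
    (h2 : 2 • P = 0) : P = 0 :=
  no_twoTorsion_of_j_eq_of_zmod W (a := 512 / 539) hj (by norm_num) (by norm_num) (by norm_num)
    (A := 539) (C := 13824) (D := 27648) (by norm_num) (by norm_num) (ℓ := 5) (by norm_num)
    (by decide) (by decide) P h2

/-- **`j = −884736 = −96³`** (CM by `ℤ[(1+√−19)/2]`; `361a`-type): NO rational point of order `2`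
(`a = 512/513`; `19Y³ − 512Y − 1024` mod `5`). [cite: SilvermanAEC2009, III §1 and App. A §3] -/
theorem no_twoTorsion_of_j_eq_neg_884736 (hj : W.j = -884736) (P : W.toAffine.Point)
    (h2 : 2 • P = 0) : P = 0 :=
  no_twoTorsion_of_j_eq_of_zmod W (a := 512 / 513) hj (by norm_num) (by norm_num) (by norm_num)
    (A := 19) (C := 512) (D := 1024) (by norm_num) (by norm_num) (ℓ := 5) (by norm_num)
    (by decide) (by decide) P h2

/-- **`j = −884736000 = −960³`** (CM by `ℤ[(1+√−43)/2]`; `1849`-type): NO rational point of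
order `2` (`a = 512000/512001`; `18963Y³ − 512000Y − 1024000` mod `11`).
[cite: SilvermanAEC2009, III §1 and App. A §3] -/
theorem no_twoTorsion_of_j_eq_neg_884736000 (hj : W.j = -884736000) (P : W.toAffine.Point)
    (h2 : 2 • P = 0) : P = 0 :=
  no_twoTorsion_of_j_eq_of_zmod W (a := 512000 / 512001) hj (by norm_num) (by norm_num)
    (by norm_num) (A := 18963) (C := 512000) (D := 1024000) (by norm_num) (by norm_num) (ℓ := 11)
    (by norm_num) (by decide) (by decide) P h2

/-- **`j = −147197952000 = −5280³`** (CM by `ℤ[(1+√−67)/2]`; `4489`-type): NO rational point of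
order `2` (`a = 85184000/85184001`; `3154963Y³ − 85184000Y − 170368000` mod `17`).
[cite: SilvermanAEC2009, III §1 and App. A §3] -/
theorem no_twoTorsion_of_j_eq_neg_147197952000 (hj : W.j = -147197952000)
    (P : W.toAffine.Point) (h2 : 2 • P = 0) : P = 0 :=
  no_twoTorsion_of_j_eq_of_zmod W (a := 85184000 / 85184001) hj (by norm_num) (by norm_num)
    (by norm_num) (A := 3154963) (C := 85184000) (D := 170368000) (by norm_num) (by norm_num)
    (ℓ := 17) (by norm_num) (by decide) (by decide) P h2

/-- **`j = −262537412640768000 = −640320³`** (CM by `ℤ[(1+√−163)/2]`; `26569`-type): NO rational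
point of order `2` (`a = 151931373056000/151931373056001`;
`5627087890963Y³ − 151931373056000Y − 303862746112000` mod `41`).
[cite: SilvermanAEC2009, III §1 and App. A §3] -/
theorem no_twoTorsion_of_j_eq_neg_262537412640768000 (hj : W.j = -262537412640768000)
    (P : W.toAffine.Point) (h2 : 2 • P = 0) : P = 0 :=
  no_twoTorsion_of_j_eq_of_zmod W (a := 151931373056000 / 151931373056001) hj (by norm_num)
    (by norm_num) (by norm_num) (A := 5627087890963) (C := 151931373056000)
    (D := 303862746112000) (by norm_num) (by norm_num) (ℓ := 41) (by norm_num) (by decide)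
    (by decide) P h2

/-- **`j = −12288000 = −3·160³`** (CM by the order `ℤ[3ζ₃]` of conductor `3` in `ℚ(√−3)`;
`27a`-type): NO rational point of order `2` (`a = 64000/64009`; `64009Y³ − 1728000Y − 3456000`
mod `7`). [cite: SilvermanAEC2009, III §1 and App. A §3] -/
theorem no_twoTorsion_of_j_eq_neg_12288000 (hj : W.j = -12288000) (P : W.toAffine.Point)
    (h2 : 2 • P = 0) : P = 0 :=
  no_twoTorsion_of_j_eq_of_zmod W (a := 64000 / 64009) hj (by norm_num) (by norm_num)
    (by norm_num) (A := 64009) (C := 1728000) (D := 3456000) (by norm_num) (by norm_num) (ℓ := 7)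
    (by norm_num) (by decide) (by decide) P h2

/-! ### In the cell's CM vocabulary (`cmFieldDiscrOfJ`) -/

/-- `d_K = −11` means `j = −32768`. [cite: SilvermanATAEC1994, App. A §3] -/
theorem j_eq_of_cmFieldDiscrOfJ_eq_neg_eleven {j : ℚ} (h : cmFieldDiscrOfJ j = -11) :
    j = -32768 := by
  unfold cmFieldDiscrOfJ at h
  split_ifs at h <;> first | assumption | omega

/-- `d_K = −19` means `j = −884736`. [cite: SilvermanATAEC1994, App. A §3] -/
theorem j_eq_of_cmFieldDiscrOfJ_eq_neg_nineteen {j : ℚ} (h : cmFieldDiscrOfJ j = -19) :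
    j = -884736 := by
  unfold cmFieldDiscrOfJ at h
  split_ifs at h <;> first | assumption | omega

/-- `d_K = −43` means `j = −884736000`. [cite: SilvermanATAEC1994, App. A §3] -/
theorem j_eq_of_cmFieldDiscrOfJ_eq_neg_fortythree {j : ℚ} (h : cmFieldDiscrOfJ j = -43) :
    j = -884736000 := by
  unfold cmFieldDiscrOfJ at h
  split_ifs at h <;> first | assumption | omega

/-- `d_K = −67` means `j = −147197952000`. [cite: SilvermanATAEC1994, App. A §3] -/
theorem j_eq_of_cmFieldDiscrOfJ_eq_neg_sixtyseven {j : ℚ} (h : cmFieldDiscrOfJ j = -67) :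
    j = -147197952000 := by
  unfold cmFieldDiscrOfJ at h
  split_ifs at h <;> first | assumption | omega

/-- `d_K = −163` means `j = −262537412640768000`. [cite: SilvermanATAEC1994, App. A §3] -/
theorem j_eq_of_cmFieldDiscrOfJ_eq_neg_onesixtythree {j : ℚ} (h : cmFieldDiscrOfJ j = -163) :
    j = -262537412640768000 := by
  unfold cmFieldDiscrOfJ at h
  split_ifs at h <;> first | assumption | omega

/-- `d_K = −3` means `j ∈ {0, 54000, −12288000}`. [cite: SilvermanATAEC1994, App. A §3] -/
theorem j_eq_of_cmFieldDiscrOfJ_eq_neg_three {j : ℚ} (h : cmFieldDiscrOfJ j = -3) :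
    j = 0 ∨ j = 54000 ∨ j = -12288000 := by
  unfold cmFieldDiscrOfJ at h
  split_ifs at h <;> first | assumption | omega

/-- CM field `ℚ(√−11)`: `E(ℚ)[2] = 0`. [cite: SilvermanAEC2009, App. A §3] -/
theorem no_twoTorsion_of_cmFieldDiscrOfJ_eq_neg_eleven (h : cmFieldDiscrOfJ W.j = -11)
    (P : W.toAffine.Point) (h2 : 2 • P = 0) : P = 0 :=
  no_twoTorsion_of_j_eq_neg_32768 W (j_eq_of_cmFieldDiscrOfJ_eq_neg_eleven h) P h2

/-- CM field `ℚ(√−19)`: `E(ℚ)[2] = 0`. [cite: SilvermanAEC2009, App. A §3] -/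
theorem no_twoTorsion_of_cmFieldDiscrOfJ_eq_neg_nineteen (h : cmFieldDiscrOfJ W.j = -19)
    (P : W.toAffine.Point) (h2 : 2 • P = 0) : P = 0 :=
  no_twoTorsion_of_j_eq_neg_884736 W (j_eq_of_cmFieldDiscrOfJ_eq_neg_nineteen h) P h2

/-- CM field `ℚ(√−43)`: `E(ℚ)[2] = 0`. [cite: SilvermanAEC2009, App. A §3] -/
theorem no_twoTorsion_of_cmFieldDiscrOfJ_eq_neg_fortythree (h : cmFieldDiscrOfJ W.j = -43)
    (P : W.toAffine.Point) (h2 : 2 • P = 0) : P = 0 :=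
  no_twoTorsion_of_j_eq_neg_884736000 W (j_eq_of_cmFieldDiscrOfJ_eq_neg_fortythree h) P h2

/-- CM field `ℚ(√−67)`: `E(ℚ)[2] = 0`. [cite: SilvermanAEC2009, App. A §3] -/
theorem no_twoTorsion_of_cmFieldDiscrOfJ_eq_neg_sixtyseven (h : cmFieldDiscrOfJ W.j = -67)
    (P : W.toAffine.Point) (h2 : 2 • P = 0) : P = 0 :=
  no_twoTorsion_of_j_eq_neg_147197952000 W (j_eq_of_cmFieldDiscrOfJ_eq_neg_sixtyseven h) P h2

/-- CM field `ℚ(√−163)`: `E(ℚ)[2] = 0`. [cite: SilvermanAEC2009, App. A §3] -/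
theorem no_twoTorsion_of_cmFieldDiscrOfJ_eq_neg_onesixtythree (h : cmFieldDiscrOfJ W.j = -163)
    (P : W.toAffine.Point) (h2 : 2 • P = 0) : P = 0 :=
  no_twoTorsion_of_j_eq_neg_262537412640768000 W
    (j_eq_of_cmFieldDiscrOfJ_eq_neg_onesixtythree h) P h2

/-- The thirteen CM `j`-invariants: `cmFieldDiscrOfJ j ≠ 0` iff `j` is one of them.
[cite: SilvermanATAEC1994, App. A §3] -/
theorem j_mem_of_cmFieldDiscrOfJ_ne_zero {j : ℚ} (h : cmFieldDiscrOfJ j ≠ 0) :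
    j = 0 ∨ j = 54000 ∨ j = -12288000 ∨ j = 1728 ∨ j = 287496 ∨ j = -3375 ∨ j = 16581375 ∨
      j = 8000 ∨ j = -32768 ∨ j = -884736 ∨ j = -884736000 ∨ j = -147197952000 ∨
      j = -262537412640768000 := by
  unfold cmFieldDiscrOfJ at h
  split_ifs at h <;> first | (exfalso; exact h rfl) | tauto

/-- **The rational `2`-torsion of CM elliptic curves over `ℚ` — the table, as one theorem.** For
`E/ℚ` whose `j`-invariant is one of the twelve CM `j`-invariants other than `0`: `E` has a rational
point of order `2` iff `d_K ∈ {−4, −7, −8}` (`K ∈ {ℚ(i), ℚ(√−7), ℚ(√−2)}`, any order) or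
`j = 54000` (the order `ℤ[√−3]`); for `d_K ∈ {−11, −19, −43, −67, −163}` and for `j = −12288000`
there is none. (`j = 0` excluded: twist-dependent.) Existence halves: `CMTwoTorsion.lean`.
[cite: SilvermanAEC2009, III §1 and App. A §3] [cite: BurungaleCastellaSkinnerTian2022, Rem. D (p. 327)] -/
theorem exists_twoTorsion_iff_of_cm_j_ne_zero (hcm : cmFieldDiscrOfJ W.j ≠ 0) (hj0 : W.j ≠ 0) :
    (∃ P : W.toAffine.Point, P ≠ 0 ∧ 2 • P = 0) ↔
      (cmFieldDiscrOfJ W.j = -4 ∨ cmFieldDiscrOfJ W.j = -7 ∨ cmFieldDiscrOfJ W.j = -8 ∨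
        W.j = 54000) := by
  constructor
  · rintro ⟨P, hP, hP2⟩
    rcases j_mem_of_cmFieldDiscrOfJ_ne_zero hcm with
      h | h | h | h | h | h | h | h | h | h | h | h | h
    · exact absurd h hj0
    · exact Or.inr (Or.inr (Or.inr h))
    · exact absurd (no_twoTorsion_of_j_eq_neg_12288000 W h P hP2) hP
    · left; rw [h]; norm_num [cmFieldDiscrOfJ]
    · left; rw [h]; norm_num [cmFieldDiscrOfJ]
    · right; left; rw [h]; norm_num [cmFieldDiscrOfJ]
    · right; left; rw [h]; norm_num [cmFieldDiscrOfJ]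
    · right; right; left; rw [h]; norm_num [cmFieldDiscrOfJ]
    · exact absurd (no_twoTorsion_of_j_eq_neg_32768 W h P hP2) hP
    · exact absurd (no_twoTorsion_of_j_eq_neg_884736 W h P hP2) hP
    · exact absurd (no_twoTorsion_of_j_eq_neg_884736000 W h P hP2) hP
    · exact absurd (no_twoTorsion_of_j_eq_neg_147197952000 W h P hP2) hP
    · exact absurd (no_twoTorsion_of_j_eq_neg_262537412640768000 W h P hP2) hP
  · rintro (h | h | h | h)
    · exact exists_twoTorsion_of_cmFieldDiscrOfJ_eq_neg_four W h
    · exact exists_twoTorsion_of_cmFieldDiscrOfJ_eq_neg_seven W h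
    · exact exists_twoTorsion_of_cmFieldDiscrOfJ_eq_neg_eight W h
    · exact exists_twoTorsion_of_j_eq_54000 W h

end OverRat

/-! ### Twist-invariance of rational `2`-torsion (any field of characteristic `0`) -/

section AnyField

variable {F : Type*} [Field F] [DecidableEq F] [CharZero F]

/-- **Rational `2`-torsion is constant on a `j`-class.** If `E₁`, `E₂` are elliptic curves over a
field `F` of characteristic `0` with `j(E₁) = j(E₂) ∉ {0, 1728}` (e.g. quadratic twists of each
other) and `E₁(F)` has a point of order `2`, so does `E₂(F)`: both are governed by the same cubic
`Y³ − 27aY − 54a`, `a = j/(j − 1728)`. [cite: SilvermanAEC2009, III §1 and X.5.4] -/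
theorem exists_twoTorsion_of_j_eq_of_exists_twoTorsion (W₁ W₂ : WeierstrassCurve F)
    [W₁.IsElliptic] [W₂.IsElliptic] (hj : W₁.j = W₂.j) (h0 : W₁.j ≠ 0) (h1728 : W₁.j ≠ 1728)
    (h₁ : ∃ P : W₁.toAffine.Point, P ≠ 0 ∧ 2 • P = 0) :
    ∃ P : W₂.toAffine.Point, P ≠ 0 ∧ 2 • P = 0 := by
  obtain ⟨P, hP, hP2⟩ := h₁
  have hne : W₁.j - 1728 ≠ 0 := sub_ne_zero.mpr h1728
  set a : F := W₁.j / (W₁.j - 1728) with ha_def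
  have ha : a * (W₁.j - 1728) = W₁.j := by
    rw [ha_def]; field_simp
  rcases P with _ | ⟨x, y, h⟩
  · exact absurd rfl hP
  obtain ⟨hY, -⟩ := yCubic_root_of_two_nsmul_eq_zero W₁ rfl h0 h1728 ha hP2
  exact exists_twoTorsion_of_j_eq W₂ hj.symm h0 h1728 ha hY

end AnyField

end Summit.BirchSwinnertonDyer.Rank1Residual.X12
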